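import Summits.QuantumAdvantage.AdviceFreeQNC0.InducedStrategy
import HarnessLib

/-!
# Cell qa-qnc0 (rung F-Q1, route RingFrame, crux α): R3 — LDMA in the row-partition regime
# (planner qa-qnc0-p1 Sketch10 §22.1b, ask P8 optional)

Statement VERBATIM from `Sketch10.lean` §22.1b (`LDMAOfRowPartition`) and PROVED:

* `pldamsZMod_of_bool` — the Boolean PLDAMS hypothesis `PLDAMSBool` in the `𝔽₂`-function dress that
  `ldma_of_pldams_fibres` consumes (a function `g : {0,1}^L → 𝔽₂` IS the indicator of its support);
* `hasDeg_rowAtom` — the atom `{u : Γ u = z}` of a column-degree-`D` map is cut out by the `2^{L'}`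
  tests `Γ u v = z v`, so its indicator has degree `≤ D·2^{L'}` (`hasDeg_forall_deg`);
* **R3 `ldma_of_rowPartition : LDMAOfRowPartition`** — LDMA with the PLDAMS constant `κ₀` for ALL
  row types whenever `D·2^{L'} ≤ D' L` (`ldma_of_pldams_fibres` with the row map itself as the fibre
  map).  As the planner notes, with `pldamsBool_sqrt` this reproduces exactly the `√(log n)` degree
  of Theorem U and nothing more.

WHAT THIS IS NOT: nothing at larger `L'`; nothing on α or the separation.
-/

noncomputable section

namespace Summit.QuantumAdvantage.AdviceFreeQNC0

open Finset
open Literature.Computability.MetaComplexity Literature.Computability.MetaComplexity.Smolensky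

/-! ### Vocabulary (verbatim from `Sketch10` §22.1b) -/

/-- **R3 — the row-partition regime**: LDMA with constant `κ₀` for ALL row types whenever
`D·2^{L'} ≤ D' L` (verbatim from `Sketch10` §22.1b). -/
def LDMAOfRowPartition : Prop :=
  ∀ κ₀ : ℝ, ∀ D' : ℕ → ℕ, PLDAMSBool κ₀ D' →
    ∃ L₀ : ℕ, ∀ L : ℕ, L₀ ≤ L → ∀ L' D : ℕ, D * 2 ^ L' ≤ D' L →
      ∀ Γ : (Fin L → Bool) → (Fin L' → Bool) → Bool, (∀ v, HasDeg (fun u => Γ u v) D) → ∀ r : ℕ,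
        κ₀ * ((∑ u : Fin L → Bool, distFail D (Γ u) : ℕ) : ℝ) ≤
          ((∑ u ∈ cls L r, distFail D (Γ u) : ℕ) : ℝ)

/-! ### Proof -/

/-- Boolean PLDAMS at degree `d` in the `𝔽₂`-function dress. -/
theorem pldamsZMod_of_bool {κ₀ : ℝ} {L d dA : ℕ} (hdA : dA ≤ d)
    (h : ∀ f : (Fin L → Bool) → Bool, HasDeg f d → ∀ r : ℕ,
      κ₀ * ((univ.filter fun u : Fin L → Bool => f u = true).card : ℝ) ≤
        ((univ.filter fun u : Fin L → Bool => f u = true ∧ wt u % 3 = r % 3).card : ℝ)) :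
    ∀ g : CubeFn (ZMod 2) L, g ∈ lowDeg (ZMod 2) L dA → ∀ r : ℕ,
      κ₀ * ((univ.filter fun u : Fin L → Bool => g u ≠ 0).card : ℝ) ≤
        ((univ.filter fun u : Fin L → Bool => g u ≠ 0 ∧ wt u % 3 = r % 3).card : ℝ) := by
  intro g hg r
  have key : ∀ a : ZMod 2, (if decide (a ≠ 0) = true then (1 : ZMod 2) else 0) = a := by decide
  have hf : HasDeg (fun u => decide (g u ≠ 0)) d := by
    unfold HasDeg
    have e : (fun x => if decide (g x ≠ 0) = true then (1 : ZMod 2) else 0) = g :=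
      funext fun x => key (g x)
    rw [e]
    exact lowDeg_mono hdA hg
  have h1 := h _ hf r
  have e1 : (univ.filter fun u : Fin L → Bool => decide (g u ≠ 0) = true) =
      univ.filter fun u : Fin L → Bool => g u ≠ 0 :=
    Finset.filter_congr fun u _ => by rw [decide_eq_true_iff]
  have e2 : (univ.filter fun u : Fin L → Bool => decide (g u ≠ 0) = true ∧ wt u % 3 = r % 3) =
      univ.filter fun u : Fin L → Bool => g u ≠ 0 ∧ wt u % 3 = r % 3 :=
    Finset.filter_congr fun u _ => by rw [decide_eq_true_iff]
  rwa [e1, e2] at h1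

/-- The row atoms of a column-degree-`D` map have indicators of degree `≤ D·2^{L'}`. -/
theorem hasDeg_rowAtom {L L' D : ℕ} (Γ : (Fin L → Bool) → (Fin L' → Bool) → Bool)
    (hΓ : ∀ v, HasDeg (fun u => Γ u v) D) (z : (Fin L' → Bool) → Bool) :
    HasDeg (fun u => decide (Γ u = z)) (D * 2 ^ L') := by
  classical
  have hcard : (univ : Finset (Fin L' → Bool)).card = 2 ^ L' := by
    rw [Finset.card_univ, Fintype.card_fun, Fintype.card_bool, Fintype.card_fin]
  rw [← hcard]
  refine hasDeg_forall_deg (univ : Finset (Fin L' → Bool)) (fun v u => decide (Γ u v = z v)) D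
    (fun v _ => hasDeg_decide_eq (hΓ v) (z v)) fun u => ?_
  simp only [decide_eq_true_eq, Finset.mem_univ, true_implies]
  exact funext_iff

/-- **R3 `LDMAOfRowPartition`.** -/
theorem ldma_of_rowPartition : LDMAOfRowPartition := by
  intro κ₀ D' hP
  obtain ⟨n₀, hn₀⟩ := hP
  refine ⟨n₀, fun L hL L' D hD Γ hΓ r => ?_⟩
  classical
  exact ldma_of_pldams_fibres (pldamsZMod_of_bool hD (hn₀ L hL)) Γ (hasDeg_rowAtom Γ hΓ)
    (fun u => distFail D (Γ u)) (fun u u' h => by rw [h]) r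

end Summit.QuantumAdvantage.AdviceFreeQNC0

end
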